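import Literature.NumberTheory.LFunctions.Zhang2022.Section10cLow1214X
import Literature.NumberTheory.LFunctions.Zhang2022.Section10cMid1214Int
import Literature.NumberTheory.LFunctions.Zhang2022.RepairGapPartIIIDoors
import HarnessLib

/-!
# Zhang (2022), rescue GAP/BED (D-0124 (3)(4)): §10 pp. 56, 60–61 — the four sum→integral passages of `S_j(𝐚₁₂,𝐚₁₄)`
# (Z22:§10.u055 (ii)/(iii) `Low1214X`/`Low1214Int`, u056 (ii) `Mid1214Int`, u057 (ii) `Top1214Int`) and the shift node
# Z22:§10.u024 (`Typed.Sec10A.Step10u024`) GUARD-FREE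

Topic `Literature/NumberTheory/LFunctions/Zhang2022` (Landau–Siegel audit tree; verdict-neutral).
Y. Zhang, *Discrete mean estimates and the Landau–Siegel zero*, arXiv:2211.02515v1 (2022)
[Zhang2022LandauSiegel] — **an unrefereed manuscript under adjudication; nothing in this file asserts or
denies its Theorems 1–2, and nothing here is a claim about Landau–Siegel zeros. The programme SEARCHES and
TYPES; no claim about Landau–Siegel zeros, Theorems 1–2 of arXiv:2211.02515 or a repaired Margin232 until a
kernel theorem says so.**

The tree closers `Typed.Sec10C.low1214X_holds` (`Section10cLow1214X`), `low1214Int_holds` (`Section10cLow1214Int`),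
`mid1214Int_holds` (`Section10cMid1214Int`), `top1214Int_holds` (`Section10cTop1214Int`) and `Typed.Sec10A.step10u024_holds`
(`Section10DirectCalculation`: «`𝔶_{μj}(P^z) = 𝔶𝔶_{μj}(z) + O(𝓛⁻⁸)`») prove their nodes OUTRIGHT; the proofs BIND the guard
`AssumptionA D χ` and never use it — the only place it is even threaded is u056 (ii)/u057 (ii), which read the shift node u024
under its (idle) guard. This file re-runs the five proofs VERBATIM with the binder deleted: **`Typed.Sec10A.step10u024_free`**,
**`Typed.Sec10C.low1214X_free`**, **`low1214Int_free`**, **`mid1214Int_free`**, **`top1214Int_free`** — for every real `c′`, every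
`ε > 0`, all large `D` and EVERY real primitive `χ (mod D)`, `j = 1, 2, 3` — whence the node bodies at guard `‖L(1,χ)‖ ≤ 𝓛⁻¹⁵`
(`…_pow15`) and under `Repair.Bed.AssumptionAWith E` for every real `E` (`…_of_assumptionAWith`). Four of the seven range inputs of
the gathering Z22:§10.u058 (`gather1214_of_ranges`, whole-DAG binder `hG1214`) at (A)-exponent 15. Theorems only; no definition, no
named fact; nothing about (A) itself. Private helpers of the source files are copied (suffix `_i14f`).

## References

* Y. Zhang, arXiv:2211.02515v1 (2022), §10 p. 56 (tex L2860–2881), pp. 60–61 (tex L3081, L3089, L3101); §8 pp. 48–49.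
  [cite: Zhang2022LandauSiegel, §10 pp. 60–61]
-/

noncomputable section

open Complex Real ComplexConjugate MeasureTheory

/-! ## Z22:§10.u024 guard-free -/

namespace Literature.NumberTheory.LFunctions.Zhang2022.Typed.Sec10A

open Literature.NumberTheory.LFunctions.Zhang2022.Skeleton


/-- `D ≥ 3 ⇒ 𝓛 = log D ≥ 1` (`e < 3`). [folklore] -/
private theorem one_le_ell_of_three_le_i14f {D : ℕ} (hD : 3 ≤ D) : 1 ≤ ell D := by
  rw [ell, Real.le_log_iff_exp_le (by positivity)]
  have h3 : (3 : ℝ) ≤ D := by exact_mod_cast hD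
  have he := Real.exp_one_lt_d9
  linarith

/-- **Z22:§10.u024 GUARD-FREE** [Z22 p.56, tex L2860–2881]: for every real `c′` there is `C` (`= 10π²|c′| + 30π³|c′| + 75π⁴c′²`)
with, for all `D ≥ 3` and EVERY real primitive `χ (mod D)` (no hypothesis on `L(1,χ)`), `j = 1, 2, 3`, `0 ≤ z ≤ 1`:
`‖𝔶_{1j}(P^z) − 𝔶𝔶_{1j}(z)‖, ‖𝔶_{2j}(P^z) − 𝔶𝔶_{2j}(z)‖ ≤ C𝓛⁻⁸` — the tree proof of `step10u024_holds` verbatim with the unused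
(A)-binder deleted. [cite: Zhang2022LandauSiegel, §10 p. 56] -/
theorem step10u024_free (c' : ℝ) :
    ∃ C : ℝ, ForAllLarge fun D _ _ =>
      ∀ j ∈ ({1, 2, 3} : Finset ℕ), ∀ z : ℝ, 0 ≤ z → z ≤ 1 →
      ‖fraky1 c' D j (bigP D ^ z) - (if j = 1 then yy11 z else if j = 2 then yy12 z else yy13 z)‖
          ≤ C * (ell D ^ 8)⁻¹ ∧
        ‖fraky2 c' D j (bigP D ^ z) - (if j = 1 then yy21 z else if j = 2 then yy22 z else yy23 z)‖
          ≤ C * (ell D ^ 8)⁻¹ := by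
  refine ⟨10 * π ^ 2 * |c'| + 30 * π ^ 3 * |c'| + 75 * π ^ 4 * c' ^ 2, 3,
    fun D _ χ hD _ _ j hj z hz0 hz1 => ?_⟩
  have hℓ : 1 ≤ ell D := one_le_ell_of_three_le_i14f hD
  obtain ⟨b1, b2, b3, b1', b2', b3'⟩ := shift_corr_bounds c' D
  obtain ⟨hJ2, hJ3, hJ4, hJ5⟩ := betaJ_two_three_four_five c' D
  have e2 := hJ2.trans (beta2_eq_shift c' D)
  have e3 := hJ3.trans (beta3_eq_shift c' D)
  have e4 := hJ4.trans (beta1_eq_shift c' D)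
  have e5 := hJ5.trans (beta2_eq_shift c' D)
  -- the printed polynomials are `yy1F/yy2F (b₁+b₂) (−b₁b₂/2)` for `(b₁,b₂) = (2,3), (3,1), (1,2)`
  have n11 : yy11 = yy1F ((2 + 3 : ℕ) : ℚ) (-((2 * 3 : ℕ) : ℚ) / 2) := by rw [yy11]; norm_num
  have n21 : yy21 = yy2F ((2 + 3 : ℕ) : ℚ) (-((2 * 3 : ℕ) : ℚ) / 2) := by rw [yy21]; norm_num
  have n12 : yy12 = yy1F ((3 + 1 : ℕ) : ℚ) (-((3 * 1 : ℕ) : ℚ) / 2) := by rw [yy12]; norm_num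
  have n22 : yy22 = yy2F ((3 + 1 : ℕ) : ℚ) (-((3 * 1 : ℕ) : ℚ) / 2) := by rw [yy22]; norm_num
  have n13 : yy13 = yy1F ((1 + 2 : ℕ) : ℚ) (-((1 * 2 : ℕ) : ℚ) / 2) := by rw [yy13]; norm_num
  have n23 : yy23 = yy2F ((1 + 2 : ℕ) : ℚ) (-((1 * 2 : ℕ) : ℚ) / 2) := by rw [yy23]; norm_num
  rw [← div_eq_mul_inv]
  simp only [Finset.mem_insert, Finset.mem_singleton] at hj
  rcases hj with rfl | rfl | rfl
  · rw [if_pos rfl, if_pos rfl, n11, n21]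
    exact ⟨norm_fraky1_rpow_sub_yy1F_le_of c' hℓ e2 e3 (by norm_num) b2 b3 b2' b3' hz0 hz1,
      norm_fraky2_rpow_sub_yy2F_le_of c' hℓ e2 e3 (by norm_num) b2 b3 b2' b3' hz0 hz1⟩
  · rw [if_neg (by norm_num), if_pos rfl, if_neg (by norm_num), if_pos rfl, n12, n22]
    exact ⟨norm_fraky1_rpow_sub_yy1F_le_of c' hℓ e3 e4 (by norm_num) b3 b1 b3' b1' hz0 hz1,
      norm_fraky2_rpow_sub_yy2F_le_of c' hℓ e3 e4 (by norm_num) b3 b1 b3' b1' hz0 hz1⟩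
  · rw [if_neg (by norm_num), if_neg (by norm_num), if_neg (by norm_num), if_neg (by norm_num),
      n13, n23]
    exact ⟨norm_fraky1_rpow_sub_yy1F_le_of c' hℓ e4 e5 (by norm_num) b1 b2 b1' b2' hz0 hz1,
      norm_fraky2_rpow_sub_yy2F_le_of c' hℓ e4 e5 (by norm_num) b1 b2 b1' b2' hz0 hz1⟩
end Literature.NumberTheory.LFunctions.Zhang2022.Typed.Sec10A

namespace Literature.NumberTheory.LFunctions.Zhang2022.Typed.Sec10C

open Literature.NumberTheory.LFunctions.Zhang2022.Skeleton

/-! ## Z22:§10.u055 (ii) guard-free -/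

section Low1214XFree


/-- Arithmetic of the final `o(α)` bound of `low1214X_holds`. [folklore] -/
private theorem arith_low_i14f {ℓ ε C₀ Mtot nK nA K₀ : ℝ} (hℓ : 1 ≤ ℓ) (hε : 0 < ε) (hC₀ : 0 ≤ C₀)
    (hMtot : 0 ≤ Mtot) (hnA0 : 0 ≤ nA) (hK₀ : 0 ≤ K₀)
    (hnK : nK ≤ K₀ * ℓ ^ 4 * (π / ℓ ^ 9) ^ 2) (hnA : nA ≤ C₀ * ℓ ^ 2 * Mtot)
    (hbig : K₀ * π * C₀ * Mtot / ε + 1 ≤ ℓ) :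
    nK * nA ≤ ε * (π / ℓ ^ 9) := by
  have hℓ0 : 0 < ℓ := by linarith
  set X : ℝ := K₀ * π * C₀ * Mtot with hX
  have hX0 : 0 ≤ X := by positivity
  have h1 : nK * nA ≤ (K₀ * ℓ ^ 4 * (π / ℓ ^ 9) ^ 2) * (C₀ * ℓ ^ 2 * Mtot) :=
    mul_le_mul hnK hnA hnA0 (by positivity)
  have h2 : (K₀ * ℓ ^ 4 * (π / ℓ ^ 9) ^ 2) * (C₀ * ℓ ^ 2 * Mtot) = (X / ℓ ^ 3) * (π / ℓ ^ 9) := by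
    rw [hX]; field_simp
  rw [h2] at h1
  refine h1.trans (mul_le_mul_of_nonneg_right ?_ (by positivity))
  rw [div_le_iff₀ (by positivity)]
  have h3 : X / ε ≤ ℓ - 1 := by linarith
  rw [div_le_iff₀ hε] at h3
  have h4 : ℓ ≤ ℓ ^ 3 := by nlinarith
  nlinarith

/-- **Z22:§10.u055 (ii) GUARD-FREE** [Z22 p.60, tex L3081, second line]: for every real `c′`, `ε > 0`, all large `D` and every real
primitive `χ (mod D)` (NO hypothesis on `L(1,χ)`), `j = 1, 2, 3`: `‖lowSum1214 − lowX1214‖ ≤ εα` ("`… = (𝔞β_{j+1}β_{j+2}/500)∫₁^{P^{0.496}}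
(ῑ₃𝔣_{j6}(P^{0.498}/x)/0.498 + ῑ₄𝔣_{j7}(P^{0.5}/x)/0.5)dx/x + o(α)`"). The tree proof of `low1214X_holds` verbatim with the unused
(A)-binder deleted. [cite: Zhang2022LandauSiegel, §10 p. 60] -/
theorem low1214X_free (c' : ℝ) :
    ∀ ε : ℝ, 0 < ε → ForAllLarge fun D _ χ => ∀ j ∈ ({1, 2, 3} : Finset ℕ),
      ‖lowSum1214 c' χ j - lowX1214 c' χ j‖ ≤ ε * alpha D := by
  intro ε hε
  obtain ⟨C₀, hC₀, hrule⟩ := lamAvg_rule c'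
  -- the constants
  obtain ⟨Kι, hKι⟩ : ∃ Kι : ℝ, Kι = ‖conj iota3 / (0.498 : ℂ)‖ + ‖conj iota4 / (0.5 : ℂ)‖ := ⟨_, rfl⟩
  obtain ⟨Mtot, hMtot⟩ : ∃ Mtot : ℝ, Mtot = 29 * Kι + 94 * Kι * π := ⟨_, rfl⟩
  obtain ⟨K₀, hK₀⟩ : ∃ K₀ : ℝ, K₀ = 0.512 * Real.exp 9 := ⟨_, rfl⟩
  obtain ⟨Ctot, hCtot⟩ : ∃ Ctot : ℝ, Ctot = K₀ * π * C₀ * Mtot := ⟨_, rfl⟩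
  have hKι0 : 0 ≤ Kι := by rw [hKι]; positivity
  have hMtot0 : 0 ≤ Mtot := by rw [hMtot]; positivity
  have hK₀0 : 0 ≤ K₀ := by rw [hK₀]; positivity
  have hCtot0 : 0 ≤ Ctot := by rw [hCtot]; positivity
  have hbig : ForAllLarge fun D _ _ => Ctot / ε + 1 ≤ ell D := by
    refine ⟨⌈Real.exp (Ctot / ε + 1)⌉₊, fun D _ χ hD _ _ => ?_⟩
    have hexp : Real.exp (Ctot / ε + 1) ≤ D := le_trans (Nat.le_ceil _) (by exact_mod_cast hD)
    show Ctot / ε + 1 ≤ Real.log D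
    exact (Real.le_log_iff_exp_le (lt_of_lt_of_le (Real.exp_pos _) hexp)).mpr hexp
  refine ((hrule.and (forAllLarge_five_c c')).and hbig).mono ?_
  intro D _ χ hq hp ⟨⟨hR, hD3, hℓ6, hc5⟩, hℓbig⟩ j _
  -- parameters
  have hD2 : 2 ≤ D := by omega
  have hℓ3 : 3 ≤ ell D := by linarith
  have hℓ1 : 1 ≤ ell D := by linarith
  have hℓ0 : 0 < ell D := by linarith
  have hΛ : Real.log (bigP D) = ell D ^ 9 := by rw [bigP, Real.log_exp]
  have hΛpos : 0 < Real.log (bigP D) := by rw [hΛ]; positivity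
  have hα : 0 < alpha D := alpha_pos hΛpos
  have hαΛ : alpha D * Real.log (bigP D) = π := by rw [alpha, div_mul_cancel₀ _ hΛpos.ne']
  have hαeq : alpha D = π / ell D ^ 9 := by rw [alpha, hΛ]
  have hP0 : 0 < bigP D := Real.exp_pos _
  have hP1 : 1 ≤ bigP D := one_le_bigP D
  have h496 : 1 ≤ bigP D ^ (0.496 : ℝ) := Real.one_le_rpow hP1 (by norm_num)
  have h498 : 1 ≤ bigP D ^ (0.498 : ℝ) := Real.one_le_rpow hP1 (by norm_num)
  have hhi1 : 1 ≤ bigP D ^ (0.5 : ℝ) := Real.one_le_rpow hP1 (by norm_num)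
  have h496_5 : bigP D ^ (0.496 : ℝ) ≤ bigP D ^ (0.5 : ℝ) :=
    Real.rpow_le_rpow_of_exponent_le hP1 (by norm_num)
  have h498_5 : bigP D ^ (0.498 : ℝ) ≤ bigP D ^ (0.5 : ℝ) :=
    Real.rpow_le_rpow_of_exponent_le hP1 (by norm_num)
  have hhiP5 : bigP D ^ (0.5 : ℝ) + 1 ≤ bigP D := by
    -- `√P + 1 ≤ P` since `√P ≥ 2` (`P = e^{𝓛⁹} ≥ e^{6⁹}`)
    have hsq : bigP D ^ (0.5 : ℝ) * bigP D ^ (0.5 : ℝ) = bigP D := by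
      rw [← Real.rpow_add hP0]; norm_num
    have h2 : 2 ≤ bigP D ^ (0.5 : ℝ) := by
      have h4 : (4 : ℝ) ≤ bigP D := by
        rw [bigP]
        have : (4 : ℝ) ≤ Real.exp 2 := by
          have h1 := Real.exp_one_gt_d9
          have h2 : Real.exp 2 = Real.exp 1 * Real.exp 1 := by rw [← Real.exp_add]; norm_num
          rw [h2]; nlinarith
        refine this.trans (Real.exp_le_exp.mpr ?_)
        calc (2 : ℝ) ≤ 6 ^ 9 := by norm_num
          _ ≤ ell D ^ 9 := pow_le_pow_left₀ (by norm_num) hℓ6 9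
      nlinarith [Real.rpow_nonneg hP0.le (0.5 : ℝ)]
    nlinarith [Real.rpow_nonneg hP0.le (0.5 : ℝ)]
  have hhiP : bigP D ^ (0.496 : ℝ) + 1 ≤ bigP D := by linarith
  have h5P : bigP D ^ (0.5 : ℝ) ≤ bigP D := by linarith
  have h498P : bigP D ^ (0.498 : ℝ) ≤ bigP D := by linarith
  -- the profile and its bounds
  obtain ⟨G, hGdef⟩ : ∃ G : ℝ → ℂ, G = fun u =>
      conj iota3 / 0.498 * frakfW c' D j 6 (bigP D ^ (0.498 : ℝ) / u) +
        conj iota4 / 0.5 * frakfW c' D j 7 (bigP D ^ (0.5 : ℝ) / u) := ⟨_, rfl⟩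
  obtain ⟨M, hM⟩ : ∃ M : ℝ, M = ‖conj iota3 / (0.498 : ℂ)‖ * 29 + ‖conj iota4 / (0.5 : ℂ)‖ * 29 :=
    ⟨_, rfl⟩
  obtain ⟨M', hM'⟩ : ∃ M' : ℝ,
      M' = ‖conj iota3 / (0.498 : ℂ)‖ * (94 * alpha D) + ‖conj iota4 / (0.5 : ℂ)‖ * (94 * alpha D) :=
    ⟨_, rfl⟩
  have hM0 : 0 ≤ M := by rw [hM]; positivity
  have hGb : ∀ t, (1 : ℝ) ≤ t → t ≤ bigP D ^ (0.496 : ℝ) + 1 →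
      DifferentiableAt ℝ G t ∧ ‖G t‖ ≤ M ∧ ‖deriv G t‖ ≤ M' / t := by
    intro t h1 h2
    rw [hGdef, hM, hM']
    exact lowG1214_bounds c' j hα hℓ0.le hc5 h498P h498 h5P hhi1 h1 (le_trans h2 hhiP)
  have hA := hR j _ _ M M' G le_rfl h496 hhiP hM0 hGb
  have hMM : M + M' * Real.log (bigP D) = Mtot := by
    rw [hMtot, hM', hM, hKι, ← hαΛ]; ring
  rw [hMM] at hA
  -- the constants `K` and `𝔞 = c_D L′²`
  obtain ⟨cD, hcD⟩ : ∃ cD : ℝ, cD = 6 / π ^ 2 * ∏ q ∈ D.primeFactors, ((q : ℝ) / (q + 1)) :=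
    ⟨_, rfl⟩
  rw [← hcD] at hA
  obtain ⟨K, hK⟩ : ∃ K : ℂ, K = deriv χ.LFunction 1 ^ 2 / 500 * (betaJ c' D (j + 1) * betaJ c' D (j + 2)) :=
    ⟨_, rfl⟩
  have hKn : ‖K‖ ≤ K₀ * ell D ^ 4 * (π / ell D ^ 9) ^ 2 := by
    rw [hK, hK₀, ← hαeq]; exact norm_KLow1214_le c' χ hℓ3 hp hα hc5 j
  -- `lowSum = K·lamAvg(G)`, `lowX = K·c_D·∫G/t`
  have hSum : lowSum1214 c' χ j = K * lamAvg c' χ j 1 (bigP D ^ (0.496 : ℝ)) (fun n => G n) := by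
    rw [hK, hGdef]; exact lowSum1214_eq c' χ j
  have hX : lowX1214 c' χ j = K * ((cD : ℂ) * ∫ t in (1 : ℝ)..bigP D ^ (0.496 : ℝ), G t / t) := by
    rw [hK, hcD, hGdef]; exact lowX1214_eq_cD c' χ hD2 hq hp j
  -- assemble
  rw [hSum, hX, ← mul_sub, norm_mul]
  rw [hCtot] at hℓbig
  have hfin := arith_low_i14f (nK := ‖K‖) hℓ1 hε hC₀ hMtot0 (norm_nonneg _) hK₀0 hKn hA hℓbig
  rw [hαeq]
  exact hfin
/-- **low1214X at (A)-exponent 15** — the node body with its guard `AssumptionA D χ` replaced by `‖L(1,χ)‖ ≤ 𝓛⁻¹⁵` (the guard is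
idle: `low1214X_free`). [cite: Zhang2022LandauSiegel, §10 p. 60] -/
theorem low1214X_pow15 (c' : ℝ) :
    ∀ ε : ℝ, 0 < ε → ForAllLarge fun D _ χ => ‖χ.LFunction 1‖ ≤ 1 / Real.log D ^ 15 →
      ∀ j ∈ ({1, 2, 3} : Finset ℕ), ‖lowSum1214 c' χ j - lowX1214 c' χ j‖ ≤ ε * alpha D :=
  fun ε hε => (low1214X_free c' ε hε).mono fun _ _ _ _ _ h _ => h

/-- **low1214X under `Repair.Bed.AssumptionAWith E`, every real `E`** (the guard is idle: `low1214X_free`; at `E = 2022` this is the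
body of the tree theorem `low1214X_holds`). [cite: Zhang2022LandauSiegel, §10 p. 60] -/
theorem low1214X_of_assumptionAWith (c' : ℝ) (E : ℝ) :
    ∀ ε : ℝ, 0 < ε → ForAllLarge fun D _ χ => Repair.Bed.AssumptionAWith E D χ →
      ∀ j ∈ ({1, 2, 3} : Finset ℕ), ‖lowSum1214 c' χ j - lowX1214 c' χ j‖ ≤ ε * alpha D :=
  fun ε hε => (low1214X_free c' ε hε).mono fun _ _ _ _ _ h _ => h

end Low1214XFree

/-! ## Z22:§10.u055 (iii) guard-free -/

section Low1214IntFree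


/-- The scalar bookkeeping of the `o(α)` bound in `low1214Int_holds`. [folklore] -/
private theorem scal_identity_i14f (K E0 U A L : ℝ) (hA : A ≠ 0) :
    (K * L ^ 4) * (6 * A ^ 2 * (1 + E0)) * (π / A) / 500 * (9 * π * U) =
      A * (54 * π ^ 2 / 500 * K * (1 + E0) * (U * L ^ 4)) := by
  field_simp
  ring

/-- **Z22:§10.u055 (iii) GUARD-FREE** [Z22 p.60, tex L3081, third line]: for every real `c′`, `ε > 0`, all large `D` and every
real primitive `χ (mod D)`, `j = 1, 2, 3`: `‖lowX1214 − lowInt1214‖ ≤ εα` (substitution `x = P^z`, reflection, `𝔣_{jμ}(P^w) = 𝔣𝔣_{jμ}(w)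
+ O(α𝓛)`, `𝔞 ≪ 𝓛⁴`). The tree proof of `low1214Int_holds` verbatim with the unused (A)-binder deleted.
[cite: Zhang2022LandauSiegel, §10 p. 60] -/
theorem low1214Int_free (c' : ℝ) :
    ∀ ε : ℝ, 0 < ε → ForAllLarge fun D _ χ => ∀ j ∈ ({1, 2, 3} : Finset ℕ),
      ‖lowX1214 c' χ j - lowInt1214 c' χ j‖ ≤ ε * alpha D := by
  intro ε hε
  obtain ⟨K, hK0, hAK⟩ : ∃ K : ℝ, 0 ≤ K ∧ ∀ (D : ℕ) [NeZero D] (χ : DirichletCharacter ℂ D),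
      3 ≤ ell D → χ.IsPrimitive → frakA χ ≤ K * ell D ^ 4 :=
    ⟨_, by positivity, fun D _ χ h hp => frakA_le_ell_pow_four χ h hp⟩
  set E0 : ℝ := 6 * (|c'| * π) + 5 * (|c'| * π) ^ 2 with hE0
  have hE00 : 0 ≤ E0 := by positivity
  set C : ℝ := 54 * π ^ 2 / 500 * K * (1 + E0) * (|c'| * π) + 1 with hC
  have hCm : 54 * π ^ 2 / 500 * K * (1 + E0) * (|c'| * π) ≤ C := by rw [hC]; linarith
  have hC1 : 1 ≤ C := by
    have : 0 ≤ 54 * π ^ 2 / 500 * K * (1 + E0) * (|c'| * π) := by positivity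
    linarith
  have hC0 : 0 < C := by linarith
  refine ⟨max 21 ⌈Real.exp (C / ε + 1)⌉₊, fun D _ χ hD _ hp j hj => ?_⟩
  have hD21 : 21 ≤ D := le_trans (le_max_left _ _) hD
  have hDexp : Real.exp (C / ε + 1) ≤ D :=
    le_trans (Nat.le_ceil _) (by exact_mod_cast le_trans (le_max_right _ _) hD)
  have hℓ3 : 3 < ell D := three_lt_log_of_le hD21
  have hℓ0 : 0 < ell D := by linarith
  have hℓ1 : 1 ≤ ell D := by linarith
  have hℓC : C / ε + 1 ≤ ell D := by
    rw [ell]; exact (Real.le_log_iff_exp_le (by positivity)).mpr hDexp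
  have hΛ : 0 < Real.log (bigP D) := by rw [bigP, Real.log_exp]; positivity
  have hα := alpha_pos hΛ
  have hA0 : 0 ≤ frakA χ := frakA_nonneg χ
  have hA : frakA χ ≤ K * ell D ^ 4 := hAK D χ hℓ3.le hp
  -- the `u = c'α𝓛` bookkeeping
  have hu : c' * alpha D * ell D = c' * π / ell D ^ 8 := by rw [mul_assoc, alpha_mul_ell hℓ0]; ring
  have hu8 : |c' * alpha D * ell D| ≤ |c'| * π := by
    rw [hu, abs_div, abs_mul, abs_of_pos Real.pi_pos, abs_of_pos (by positivity : 0 < ell D ^ 8)]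
    exact div_le_self (by positivity) (one_le_pow₀ hℓ1)
  have hu4 : |c' * alpha D * ell D| * ell D ^ 4 = |c'| * π * (ell D ^ 4)⁻¹ := by
    rw [hu, abs_div, abs_mul, abs_of_pos Real.pi_pos, abs_of_pos (by positivity : 0 < ell D ^ 8)]
    field_simp
  obtain ⟨n, E, -, hn, hE, hprod⟩ := betaJ_pair c' D hj
  have hE1 : |E| ≤ E0 := by
    refine hE.trans ?_
    rw [hE0]
    have : (c' * alpha D * ell D) ^ 2 ≤ (|c'| * π) ^ 2 := by
      rw [← sq_abs]; exact pow_le_pow_left₀ (abs_nonneg _) hu8 2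
    linarith
  -- assemble
  rw [lowX1214_eq_z c' χ j hΛ.le, lowInt1214, ← mul_sub, norm_mul, norm_pref1214_eq c' χ hΛ hprod]
  have hn6 : (n : ℝ) * alpha D ^ 2 * |1 + E| ≤ 6 * alpha D ^ 2 * (1 + E0) := by
    have : |1 + E| ≤ 1 + E0 := (abs_add_le _ _).trans (by rw [abs_one]; linarith)
    gcongr
  have hpref_le : frakA χ * ((n : ℝ) * alpha D ^ 2 * |1 + E|) * (π / alpha D) / 500 ≤
      (K * ell D ^ 4) * (6 * alpha D ^ 2 * (1 + E0)) * (π / alpha D) / 500 := by gcongr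
  have hℓ4 : ell D ≤ ell D ^ 4 := by
    calc ell D = ell D ^ 1 := (pow_one _).symm
      _ ≤ ell D ^ 4 := pow_le_pow_right₀ hℓ1 (by norm_num)
  have hfin : C * (ell D)⁻¹ ≤ ε := by
    rw [mul_inv_le_iff₀ hℓ0]
    have : C / ε ≤ ell D := by linarith
    rw [div_le_iff₀ hε] at this
    linarith
  refine (mul_le_mul hpref_le (norm_lowInt_sub_le c' hΛ hj) (norm_nonneg _) (by positivity)).trans ?_
  rw [scal_identity_i14f K E0 |c' * alpha D * ell D| (alpha D) (ell D) hα.ne', hu4]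
  have step : 54 * π ^ 2 / 500 * K * (1 + E0) * (|c'| * π * (ell D ^ 4)⁻¹) ≤ ε := by
    calc 54 * π ^ 2 / 500 * K * (1 + E0) * (|c'| * π * (ell D ^ 4)⁻¹)
        = (54 * π ^ 2 / 500 * K * (1 + E0) * (|c'| * π)) * (ell D ^ 4)⁻¹ := by ring
      _ ≤ C * (ell D ^ 4)⁻¹ := mul_le_mul_of_nonneg_right hCm (by positivity)
      _ ≤ C * (ell D)⁻¹ := by gcongr
      _ ≤ ε := hfin
  calc alpha D * (54 * π ^ 2 / 500 * K * (1 + E0) * (|c'| * π * (ell D ^ 4)⁻¹))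
      ≤ alpha D * ε := mul_le_mul_of_nonneg_left step hα.le
    _ = ε * alpha D := mul_comm _ _
/-- **low1214Int at (A)-exponent 15** — the node body with its guard `AssumptionA D χ` replaced by `‖L(1,χ)‖ ≤ 𝓛⁻¹⁵` (the guard is
idle: `low1214Int_free`). [cite: Zhang2022LandauSiegel, §10 p. 60] -/
theorem low1214Int_pow15 (c' : ℝ) :
    ∀ ε : ℝ, 0 < ε → ForAllLarge fun D _ χ => ‖χ.LFunction 1‖ ≤ 1 / Real.log D ^ 15 →
      ∀ j ∈ ({1, 2, 3} : Finset ℕ), ‖lowX1214 c' χ j - lowInt1214 c' χ j‖ ≤ ε * alpha D :=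
  fun ε hε => (low1214Int_free c' ε hε).mono fun _ _ _ _ _ h _ => h

/-- **low1214Int under `Repair.Bed.AssumptionAWith E`, every real `E`** (the guard is idle: `low1214Int_free`; at `E = 2022` this is the
body of the tree theorem `low1214Int_holds`). [cite: Zhang2022LandauSiegel, §10 p. 60] -/
theorem low1214Int_of_assumptionAWith (c' : ℝ) (E : ℝ) :
    ∀ ε : ℝ, 0 < ε → ForAllLarge fun D _ χ => Repair.Bed.AssumptionAWith E D χ →
      ∀ j ∈ ({1, 2, 3} : Finset ℕ), ‖lowX1214 c' χ j - lowInt1214 c' χ j‖ ≤ ε * alpha D :=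
  fun ε hε => (low1214Int_free c' ε hε).mono fun _ _ _ _ _ h _ => h

end Low1214IntFree

/-! ## Z22:§10.u056 (ii) guard-free -/

section Mid1214IntFree

/-- **Z22:§10.u056 (ii) GUARD-FREE** [Z22 p.61, tex L3089, second line]: for every real `c′`, `ε > 0`, all large `D` and every real
primitive `χ (mod D)`, `j = 1, 2, 3`: `‖midSum1214 − midInt1214‖ ≤ εα`. The tree proof of `mid1214Int_holds` verbatim with the shift
node u024 taken guard-free (`Sec10A.step10u024_free`) and the unused (A)-binder deleted. [cite: Zhang2022LandauSiegel, §10 p. 61] -/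
theorem mid1214Int_free (c' : ℝ) :
    ∀ ε : ℝ, 0 < ε → ForAllLarge fun D _ χ => ∀ j ∈ ({1, 2, 3} : Finset ℕ),
      ‖midSum1214 c' χ j - midInt1214 χ j‖ ≤ ε * alpha D := by
  intro ε hε
  obtain ⟨C₂₄, h24⟩ := Sec10A.step10u024_free c'
  set C₀ : ℝ := 417 * (36 * π ^ 2 * |c'|) + 44 * |C₂₄| with hC₀
  have hC₀0 : 0 ≤ C₀ := by positivity
  have hgen := lamAvg_second_line c' (500 : ℂ) (a := 0.496) (b := 0.498) (M := 87153)
    (M' := 324109) (C₀ := C₀) (by norm_num) (by norm_num) (by norm_num) (by norm_num) (by norm_num)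
    hC₀0 ε hε
  have h5 := forAllLarge_ell_six (5 * c')
  refine ((hgen.and h24).and h5).mono ?_
  intro D _ χ hq hp ⟨⟨hG, h24D⟩, hℓ6, hc5⟩ j hj
  -- parameters
  have hℓ0 : 0 < ell D := by linarith
  have hP : 0 < bigP D := Real.exp_pos _
  have hP1 : 1 < bigP D := by rw [bigP]; exact Real.one_lt_exp_iff.2 (pow_pos hℓ0 9)
  have hlogP : Real.log (bigP D) = ell D ^ 9 := by rw [bigP, Real.log_exp]
  have hΛ : 0 < Real.log (bigP D) := by rw [hlogP]; positivity
  have hα : 0 < alpha D := alpha_pos hΛ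
  have hαℓ : alpha D * ell D = π / ell D ^ 8 := alpha_mul_ell hℓ0
  have hΛ4 : alpha D * Real.log (bigP D) ≤ 4 := by
    rw [alpha, div_mul_cancel₀ _ hΛ.ne']; linarith [Real.pi_lt_d2]
  have hc : 5 * |c'| * alpha D * ell D ≤ 1 := by
    have : |5 * c'| = 5 * |c'| := by rw [abs_mul, abs_of_pos (by norm_num : (0:ℝ) < 5)]
    rw [this] at hc5; linarith [hc5]
  have hlo1 : 1 ≤ bigP D ^ (0.496 : ℝ) := Real.one_le_rpow hP1.le (by norm_num)
  have hhiP : bigP D ^ (0.498 : ℝ) + 1 ≤ bigP D :=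
    rpow_add_one_le_bigP (by norm_num) (by norm_num) (by linarith) (by nlinarith)
  -- the profile and its main value
  set F : ℝ → ℂ := fun t => (conj iota3 * frakfW c' D j 6 (bigP D ^ (0.498 : ℝ) / t) / 0.498 +
      conj iota4 * frakfW c' D j 7 (bigP D ^ (0.5 : ℝ) / t) / 0.5) *
    (-1 + fraky1 c' D j (bigP D ^ (0.004 : ℝ) * t)) with hF
  set H : ℝ → ℂ := fun u => (conj iota3 * ffJ6 j u / 0.498 + conj iota4 * ffJ7 j (0.002 + u) / 0.5) *
    (-1 + yyJ1 j (0.502 - u)) with hH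
  set G₀ : ℝ → ℂ := fun z => H (0.498 - z) with hG₀
  have hprof : ∀ t : ℝ, bigP D ^ (0.496 : ℝ) ≤ t → t ≤ bigP D ^ (0.498 : ℝ) + 1 →
      DifferentiableAt ℝ F t ∧ ‖F t‖ ≤ 87153 ∧ ‖deriv F t‖ ≤ 324109 * alpha D / t := by
    intro t h1 h2
    exact midProfile_bounds c' j hα hℓ0.le hc (hlo1.trans h1) (h2.trans hhiP) hΛ4
  have hG₀i : IntervalIntegrable G₀ volume (0.496 : ℝ) 0.498 := by
    apply Continuous.intervalIntegrable
    rw [hG₀, hH]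
    fun_prop
  have happrox : ∀ z ∈ Set.Icc (0.496 : ℝ) 0.498, ‖F (bigP D ^ z) - G₀ z‖ ≤ C₀ / ell D ^ 8 := by
    intro z hz
    obtain ⟨hz1, hz2⟩ := hz
    set f₆ : ℂ := frakfW c' D j 6 (bigP D ^ (0.498 : ℝ) / bigP D ^ z) with hf₆
    set f₇ : ℂ := frakfW c' D j 7 (bigP D ^ (0.5 : ℝ) / bigP D ^ z) with hf₇
    set y : ℂ := -1 + fraky1 c' D j (bigP D ^ (0.004 : ℝ) * bigP D ^ z) with hy
    set f₆₀ : ℂ := ffJ6 j (0.498 - z) with hf₆₀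
    set f₇₀ : ℂ := ffJ7 j (0.002 + (0.498 - z)) with hf₇₀
    set y₀ : ℂ := -1 + yyJ1 j (0.502 - (0.498 - z)) with hy₀
    have eF : F (bigP D ^ z) - G₀ z =
        (conj iota3 * (f₆ - f₆₀) / 0.498 + conj iota4 * (f₇ - f₇₀) / 0.5) * y +
          (conj iota3 * f₆₀ / 0.498 + conj iota4 * f₇₀ / 0.5) * (y - y₀) := by
      simp only [hF, hG₀, hH, hf₆, hf₇, hy, hf₆₀, hf₇₀, hy₀]; ring
    have hu : |c' * alpha D * ell D| = |c'| * (π / ell D ^ 8) := by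
      rw [mul_assoc, abs_mul, hαℓ, abs_of_pos (show (0:ℝ) < π / ell D ^ 8 by positivity)]
    have hw6 : |(0.498 : ℝ) - z| ≤ 1 := by rw [abs_le]; constructor <;> linarith
    have hw7 : |(0.5 : ℝ) - z| ≤ 1 := by rw [abs_le]; constructor <;> linarith
    have h6 : ‖f₆ - f₆₀‖ ≤ 5 * π ^ 2 * |c'| / ell D ^ 8 := by
      rw [hf₆, hf₆₀, frakfW6_at_rpow]
      refine (norm_frakf_sub_ffJ (c' := c') hΛ hj (0.498 - z)).1.trans ?_
      rw [hu]
      calc 5 * π * (|c'| * (π / ell D ^ 8)) * |(0.498 : ℝ) - z|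
          ≤ 5 * π * (|c'| * (π / ell D ^ 8)) * 1 := by gcongr
        _ = 5 * π ^ 2 * |c'| / ell D ^ 8 := by ring
    have h7 : ‖f₇ - f₇₀‖ ≤ 5 * π ^ 2 * |c'| / ell D ^ 8 := by
      rw [hf₇, hf₇₀, frakfW7_at_rpow, show (0.002 : ℝ) + (0.498 - z) = 0.5 - z by ring]
      refine (norm_frakf_sub_ffJ (c' := c') hΛ hj (0.5 - z)).2.trans ?_
      rw [hu]
      calc 5 * π * (|c'| * (π / ell D ^ 8)) * |(0.5 : ℝ) - z|
          ≤ 5 * π * (|c'| * (π / ell D ^ 8)) * 1 := by gcongr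
        _ = 5 * π ^ 2 * |c'| / ell D ^ 8 := by ring
    have hAd : ‖conj iota3 * (f₆ - f₆₀) / 0.498 + conj iota4 * (f₇ - f₇₀) / 0.5‖ ≤
        7.2 * (5 * π ^ 2 * |c'| / ell D ^ 8) := norm_iotaComb_le _ _ h6 h7
    have hA₀ : ‖conj iota3 * f₆₀ / 0.498 + conj iota4 * f₇₀ / 0.5‖ ≤ 7.2 * 6 :=
      norm_iotaComb_le _ _ (norm_ffJ6_le j hw6)
        (norm_ffJ7_le j (by rw [show (0.002 : ℝ) + (0.498 - z) = 0.5 - z by ring]; exact hw7))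
    -- `‖y‖ ≤ 417`
    have hyn : ‖y‖ ≤ 417 := by
      have hPz1 : 1 ≤ bigP D ^ z := Real.one_le_rpow hP1.le (by linarith)
      have hPzP : bigP D ^ z ≤ bigP D := by
        calc bigP D ^ z ≤ bigP D ^ (1 : ℝ) := Real.rpow_le_rpow_of_exponent_le hP1.le (by linarith)
          _ = bigP D := Real.rpow_one _
      exact (y1Profile_bounds c' j hα hℓ0.le hc hPz1 hPzP hΛ4).2.1
    -- `‖y − y₀‖ ≤ |C₂₄|𝓛⁻⁸` (Z22:§10.u024 at `w = z + 0.004`)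
    have hyy : ‖y - y₀‖ ≤ |C₂₄| / ell D ^ 8 := by
      have hw0 : (0 : ℝ) ≤ 0.502 - (0.498 - z) := by linarith
      have hw1 : 0.502 - (0.498 - z) ≤ (1 : ℝ) := by linarith
      have h := (h24D j hj (0.502 - (0.498 - z)) hw0 hw1).1
      have ew : bigP D ^ (0.004 : ℝ) * bigP D ^ z = bigP D ^ ((0.502 : ℝ) - (0.498 - z)) := by
        rw [← Real.rpow_add hP]; congr 1; ring
      have ey : y - y₀ = fraky1 c' D j (bigP D ^ ((0.502 : ℝ) - (0.498 - z))) -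
          (if j = 1 then yy11 (0.502 - (0.498 - z)) else if j = 2 then yy12 (0.502 - (0.498 - z))
            else yy13 (0.502 - (0.498 - z))) := by
        rw [hy, hy₀, ew, yyJ1_apply]; ring
      rw [ey]
      refine h.trans ?_
      rw [← div_eq_mul_inv]
      gcongr
      exact le_abs_self _
    rw [eF]
    calc _ ≤ ‖conj iota3 * (f₆ - f₆₀) / 0.498 + conj iota4 * (f₇ - f₇₀) / 0.5‖ * ‖y‖ +
          ‖conj iota3 * f₆₀ / 0.498 + conj iota4 * f₇₀ / 0.5‖ * ‖y - y₀‖ := by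
          refine (norm_add_le _ _).trans ?_; rw [norm_mul, norm_mul]
      _ ≤ 7.2 * (5 * π ^ 2 * |c'| / ell D ^ 8) * 417 + 7.2 * 6 * (|C₂₄| / ell D ^ 8) :=
          add_le_add (mul_le_mul hAd hyn (norm_nonneg _) (by positivity))
            (mul_le_mul hA₀ hyy (norm_nonneg _) (by norm_num))
      _ = (15012 * (π ^ 2 * |c'|) + 43.2 * |C₂₄|) / ell D ^ 8 := by ring
      _ ≤ C₀ / ell D ^ 8 := by
          rw [hC₀]
          exact div_le_div_of_nonneg_right (by linarith [abs_nonneg C₂₄]) (by positivity)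
  -- the engine
  have key := hG j F G₀ hprof hG₀i happrox
  have hsub : ∫ z in (0.496 : ℝ)..0.498, G₀ z = ∫ u in (0 : ℝ)..0.002, H u := by
    rw [hG₀]; exact integral_mid_reflect H
  rw [hsub] at key
  have eS : midSum1214 c' χ j = (500 : ℂ) * deriv χ.LFunction 1 ^ 2 /
      (Real.log (bigP D) : ℂ) ^ 2 * lamAvg c' χ j (bigP D ^ (0.496 : ℝ)) (bigP D ^ (0.498 : ℝ))
        (fun n => F n) := by
    simp only [midSum1214, hF]
  have eI : midInt1214 χ j = (500 : ℂ) * (frakA χ : ℂ) / (Real.log (bigP D) : ℂ) *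
      ∫ u in (0 : ℝ)..0.002, H u := by
    simp only [midInt1214, hH]
  rw [eS, eI]
  exact key
/-- **mid1214Int at (A)-exponent 15** — the node body with its guard `AssumptionA D χ` replaced by `‖L(1,χ)‖ ≤ 𝓛⁻¹⁵` (the guard is
idle: `mid1214Int_free`). [cite: Zhang2022LandauSiegel, §10 p. 61] -/
theorem mid1214Int_pow15 (c' : ℝ) :
    ∀ ε : ℝ, 0 < ε → ForAllLarge fun D _ χ => ‖χ.LFunction 1‖ ≤ 1 / Real.log D ^ 15 →
      ∀ j ∈ ({1, 2, 3} : Finset ℕ), ‖midSum1214 c' χ j - midInt1214 χ j‖ ≤ ε * alpha D :=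
  fun ε hε => (mid1214Int_free c' ε hε).mono fun _ _ _ _ _ h _ => h

/-- **mid1214Int under `Repair.Bed.AssumptionAWith E`, every real `E`** (the guard is idle: `mid1214Int_free`; at `E = 2022` this is the
body of the tree theorem `mid1214Int_holds`). [cite: Zhang2022LandauSiegel, §10 p. 61] -/
theorem mid1214Int_of_assumptionAWith (c' : ℝ) (E : ℝ) :
    ∀ ε : ℝ, 0 < ε → ForAllLarge fun D _ χ => Repair.Bed.AssumptionAWith E D χ →
      ∀ j ∈ ({1, 2, 3} : Finset ℕ), ‖midSum1214 c' χ j - midInt1214 χ j‖ ≤ ε * alpha D :=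
  fun ε hε => (mid1214Int_free c' ε hε).mono fun _ _ _ _ _ h _ => h

end Mid1214IntFree

/-! ## Z22:§10.u057 (ii) guard-free -/

section Top1214IntFree

/-- **Z22:§10.u057 (ii) GUARD-FREE** [Z22 p.61, tex L3101, second line]: for every real `c′`, `ε > 0`, all large `D` and every real
primitive `χ (mod D)`, `j = 1, 2, 3`: `‖topSum1214 − topInt1214‖ ≤ εα`. The tree proof of `top1214Int_holds` verbatim with the shift
node u024 taken guard-free (`Sec10A.step10u024_free`) and the unused (A)-binder deleted. [cite: Zhang2022LandauSiegel, §10 p. 61] -/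
theorem top1214Int_free (c' : ℝ) :
    ∀ ε : ℝ, 0 < ε → ForAllLarge fun D _ χ => ∀ j ∈ ({1, 2, 3} : Finset ℕ),
      ‖topSum1214 c' χ j - topInt1214 χ j‖ ≤ ε * alpha D := by
  intro ε hε
  obtain ⟨C₂₄, h24⟩ := Sec10A.step10u024_free c'
  set C₀ : ℝ := 161 * (5 * π ^ 2 * |c'|) + 6 * |C₂₄| with hC₀
  have hC₀0 : 0 ≤ C₀ := by positivity
  have hgen := lamAvg_second_line c' (1000 * conj iota4) (a := 0.498) (b := 0.5) (M := 4669)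
    (M' := 17222) (C₀ := C₀) (by norm_num) (by norm_num) (by norm_num) (by norm_num) (by norm_num)
    hC₀0 ε hε
  have h5 := forAllLarge_ell_six (5 * c')
  refine ((hgen.and h24).and h5).mono ?_
  intro D _ χ hq hp ⟨⟨hG, h24D⟩, hℓ6, hc5⟩ j hj
  -- parameters
  have hℓ0 : 0 < ell D := by linarith
  have hℓ1 : 1 ≤ ell D := by linarith
  have hP : 0 < bigP D := Real.exp_pos _
  have hP1 : 1 < bigP D := by rw [bigP]; exact Real.one_lt_exp_iff.2 (pow_pos hℓ0 9)
  have hlogP : Real.log (bigP D) = ell D ^ 9 := by rw [bigP, Real.log_exp]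
  have hΛ : 0 < Real.log (bigP D) := by rw [hlogP]; positivity
  have hα : 0 < alpha D := alpha_pos hΛ
  have hαℓ : alpha D * ell D = π / ell D ^ 8 := alpha_mul_ell hℓ0
  have hΛ4 : alpha D * Real.log (bigP D) ≤ 4 := by
    rw [alpha, div_mul_cancel₀ _ hΛ.ne']; linarith [Real.pi_lt_d2]
  have hc : 5 * |c'| * alpha D * ell D ≤ 1 := by
    have : |5 * c'| = 5 * |c'| := by rw [abs_mul, abs_of_pos (by norm_num : (0:ℝ) < 5)]
    rw [this] at hc5; linarith [hc5]
  obtain ⟨hQ1, hQP, hQP1⟩ := sqrtP_facts (D := D) (by linarith)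
  have hlo1 : 1 ≤ bigP D ^ (0.498 : ℝ) := Real.one_le_rpow hP1.le (by norm_num)
  -- the profile and its main value
  set F : ℝ → ℂ := fun t => frakfW c' D j 7 (bigP D ^ (0.5 : ℝ) / t) *
    (1 + fraky2 c' D j (bigP D ^ (0.004 : ℝ) * t)) with hF
  set H : ℝ → ℂ := fun u => ffJ7 j u * (1 + yyJ2 j (0.504 - u)) with hH
  set G₀ : ℝ → ℂ := fun z => H (0.5 - z) with hG₀
  have hprof : ∀ t : ℝ, bigP D ^ (0.498 : ℝ) ≤ t → t ≤ bigP D ^ (0.5 : ℝ) + 1 →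
      DifferentiableAt ℝ F t ∧ ‖F t‖ ≤ 4669 ∧ ‖deriv F t‖ ≤ 17222 * alpha D / t := by
    intro t h1 h2
    exact topProfile_bounds c' j hα hℓ0.le hc (hlo1.trans h1) (h2.trans hQP1) hΛ4 hQ1 hQP
  have hG₀i : IntervalIntegrable G₀ volume (0.498 : ℝ) 0.5 := by
    apply Continuous.intervalIntegrable
    rw [hG₀, hH]
    fun_prop
  have happrox : ∀ z ∈ Set.Icc (0.498 : ℝ) 0.5, ‖F (bigP D ^ z) - G₀ z‖ ≤ C₀ / ell D ^ 8 := by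
    intro z hz
    obtain ⟨hz1, hz2⟩ := hz
    -- the two factors and their main values
    set f : ℂ := frakfW c' D j 7 (bigP D ^ (0.5 : ℝ) / bigP D ^ z) with hf
    set g : ℂ := 1 + fraky2 c' D j (bigP D ^ (0.004 : ℝ) * bigP D ^ z) with hg
    set f₀ : ℂ := ffJ7 j (0.5 - z) with hf₀
    set g₀ : ℂ := 1 + yyJ2 j (0.504 - (0.5 - z)) with hg₀
    have eF : F (bigP D ^ z) - G₀ z = (f - f₀) * g + f₀ * (g - g₀) := by
      simp only [hF, hG₀, hH, hf, hg, hf₀, hg₀]; ring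
    -- `‖f − f₀‖ ≤ 5π²|c′|𝓛⁻⁸`
    have hff : ‖f - f₀‖ ≤ 5 * π ^ 2 * |c'| / ell D ^ 8 := by
      rw [hf, hf₀, frakfW7_at_rpow]
      refine (norm_frakf_sub_ffJ (c' := c') hΛ hj (0.5 - z)).2.trans ?_
      have hw : |(0.5 : ℝ) - z| ≤ 1 := by rw [abs_le]; constructor <;> linarith
      have hu : |c' * alpha D * ell D| = |c'| * (π / ell D ^ 8) := by
        rw [mul_assoc, abs_mul, hαℓ, abs_of_pos (show (0:ℝ) < π / ell D ^ 8 by positivity)]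
      rw [hu]
      calc 5 * π * (|c'| * (π / ell D ^ 8)) * |(0.5 : ℝ) - z|
          ≤ 5 * π * (|c'| * (π / ell D ^ 8)) * 1 := by gcongr
        _ = 5 * π ^ 2 * |c'| / ell D ^ 8 := by ring
    -- `‖g‖ ≤ 161`
    have hgn : ‖g‖ ≤ 161 := by
      have hPz1 : 1 ≤ bigP D ^ z := Real.one_le_rpow hP1.le (by linarith)
      have hPzP : bigP D ^ z ≤ bigP D := by
        calc bigP D ^ z ≤ bigP D ^ (1 : ℝ) := Real.rpow_le_rpow_of_exponent_le hP1.le (by linarith)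
          _ = bigP D := Real.rpow_one _
      exact (y2Profile_bounds c' j hα hℓ0.le hc hPz1 hPzP hΛ4 hQ1 hQP).2.1
    -- `‖f₀‖ ≤ 6`
    have hf₀n : ‖f₀‖ ≤ 6 := norm_ffJ7_le j (by rw [abs_le]; constructor <;> linarith)
    -- `‖g − g₀‖ ≤ |C₂₄|𝓛⁻⁸` (Z22:§10.u024 at `w = z + 0.004`)
    have hgg : ‖g - g₀‖ ≤ |C₂₄| / ell D ^ 8 := by
      have hw0 : (0 : ℝ) ≤ 0.504 - (0.5 - z) := by linarith
      have hw1 : 0.504 - (0.5 - z) ≤ (1 : ℝ) := by linarith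
      have h := (h24D j hj (0.504 - (0.5 - z)) hw0 hw1).2
      have ew : bigP D ^ (0.004 : ℝ) * bigP D ^ z = bigP D ^ ((0.504 : ℝ) - (0.5 - z)) := by
        rw [← Real.rpow_add hP]; congr 1; ring
      have eg : g - g₀ = fraky2 c' D j (bigP D ^ ((0.504 : ℝ) - (0.5 - z))) -
          (if j = 1 then yy21 (0.504 - (0.5 - z)) else if j = 2 then yy22 (0.504 - (0.5 - z))
            else yy23 (0.504 - (0.5 - z))) := by
        rw [hg, hg₀, ew, yyJ2_apply]; ring
      rw [eg]
      refine h.trans ?_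
      rw [← div_eq_mul_inv]
      gcongr
      exact le_abs_self _
    rw [eF]
    calc ‖(f - f₀) * g + f₀ * (g - g₀)‖ ≤ ‖f - f₀‖ * ‖g‖ + ‖f₀‖ * ‖g - g₀‖ := by
          refine (norm_add_le _ _).trans ?_; rw [norm_mul, norm_mul]
      _ ≤ 5 * π ^ 2 * |c'| / ell D ^ 8 * 161 + 6 * (|C₂₄| / ell D ^ 8) :=
          add_le_add (mul_le_mul hff hgn (norm_nonneg _) (by positivity))
            (mul_le_mul hf₀n hgg (norm_nonneg _) (by norm_num))
      _ = C₀ / ell D ^ 8 := by rw [hC₀]; ring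
  -- the engine
  have key := hG j F G₀ hprof hG₀i happrox
  have hsub : ∫ z in (0.498 : ℝ)..0.5, G₀ z = ∫ u in (0 : ℝ)..0.002, H u := by
    rw [hG₀]; exact integral_top_reflect H
  rw [hsub] at key
  have eS : topSum1214 c' χ j = 1000 * conj iota4 * deriv χ.LFunction 1 ^ 2 /
      (Real.log (bigP D) : ℂ) ^ 2 * lamAvg c' χ j (bigP D ^ (0.498 : ℝ)) (bigP D ^ (0.5 : ℝ))
        (fun n => F n) := by
    simp only [topSum1214, hF]
  have eI : topInt1214 χ j = 1000 * conj iota4 * (frakA χ : ℂ) / (Real.log (bigP D) : ℂ) *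
      ∫ u in (0 : ℝ)..0.002, H u := by
    simp only [topInt1214, hH]
  rw [eS, eI]
  exact key
/-- **top1214Int at (A)-exponent 15** — the node body with its guard `AssumptionA D χ` replaced by `‖L(1,χ)‖ ≤ 𝓛⁻¹⁵` (the guard is
idle: `top1214Int_free`). [cite: Zhang2022LandauSiegel, §10 p. 61] -/
theorem top1214Int_pow15 (c' : ℝ) :
    ∀ ε : ℝ, 0 < ε → ForAllLarge fun D _ χ => ‖χ.LFunction 1‖ ≤ 1 / Real.log D ^ 15 →
      ∀ j ∈ ({1, 2, 3} : Finset ℕ), ‖topSum1214 c' χ j - topInt1214 χ j‖ ≤ ε * alpha D :=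
  fun ε hε => (top1214Int_free c' ε hε).mono fun _ _ _ _ _ h _ => h

/-- **top1214Int under `Repair.Bed.AssumptionAWith E`, every real `E`** (the guard is idle: `top1214Int_free`; at `E = 2022` this is the
body of the tree theorem `top1214Int_holds`). [cite: Zhang2022LandauSiegel, §10 p. 61] -/
theorem top1214Int_of_assumptionAWith (c' : ℝ) (E : ℝ) :
    ∀ ε : ℝ, 0 < ε → ForAllLarge fun D _ χ => Repair.Bed.AssumptionAWith E D χ →
      ∀ j ∈ ({1, 2, 3} : Finset ℕ), ‖topSum1214 c' χ j - topInt1214 χ j‖ ≤ ε * alpha D :=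
  fun ε hε => (top1214Int_free c' ε hε).mono fun _ _ _ _ _ h _ => h

end Top1214IntFree

end Literature.NumberTheory.LFunctions.Zhang2022.Typed.Sec10C

end
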